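import Literature.AnabelianGeometry.EtaleTheta.Discharge.Sec2Cor28iArbitraryAut
import Literature.AnabelianGeometry.EtaleTheta.Discharge.Sec2Cor28iBindersOfSection
import HarnessLib

/-!
# [EtTh] Cor 2.8 (i) at the SECTION-route cover, for an ARBITRARY automorphism `Γ` of `Π^tp_C` restricting to
# `Π^tp_X`, modulo UNIT-FREE theta rigidity ALONE (proof-only knit, generic over the constructor's binders)

S. Mochizuki, *The étale theta function and its Frobenioid-theoretic manifestations* [EtTh], Publ. RIMS **45**
(2009), §2, Cor 2.8 (i) PRIMS PDF p.42; Prop 2.4 p.38, Def 2.7 p.41; §1 Thm 1.6 (ii)/(iii) p.24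
(bib key `MochizukiEtTh2009`).

PROOF-ONLY companion (0 `def`, 0 `instance`, no new `Prop`; cell abc-iut, layer L2, seat abc-iut-L2-t1 gen 12 —
abc-iut-L2-lead R1375 KEY «F3b», VNEXT note N-C28I-2; sequel of this seat's `Sec2OrbitEmbeddingUnitTransport` (F1) and
`Sec2Cor28iArbitraryAut` (F3); every input BY NAME).
* §1 **`MuTwoSetting.CLevelData.cor28_i_of_comm_orbitEmbeddingOfHuuOfSection`** — abc-iut-w6-d049's
  `cor28_i_outer_orbitEmbeddingOfHuuOfSection` (inner `Γ = γ_y`) for an ARBITRARY `Γ : Π^tp_C ≃ₜ* Π^tp_C` at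
  abc-iut-L2-d3's SECTION-route cover `orbitEmbeddingOfHuuOfSection`: given the restriction `α` of `Γ` to `Π^tp_X`
  (`ι ∘ α = Γ ∘ ι`, Prop 2.4) with `α(Δ^tp_X) = Δ^tp_X` ([AbsAnab] 1.3.8 BY NAME), the companion is abc-iut-L6-d5's
  `Thm16Sub.topCompanion` (Thm 1.6 (ii), granted `IsQuotientMap toTheta`), and ALL FOUR conclusions of `Cor28_i` hold
  modulo `Cor28_i`'s own binders and the UNIT-FREE rigidity identity `autMap α⁻¹ β⁻¹ η̈^Θ = σ₀·η̈^Θ`, `σ₀ ∈ Π^tp_{X̲̲}`;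
* the specialisation to THE cover of record over `χ′` (where `IsStandard`, `IsQuotientMap toTheta`, `Compat`, `Sec2Hyps`
  are theorems) is the sequel `Sec2Cor28iCoverOfRecordThetaRigidityAlone`.
WHAT IS NOT CLAIMED: the rigidity identity (the [EtTh] Thm 1.6 (iii) content, unit `1`) stays a HYPOTHESIS; with a
GENUINE unit the transport is only a twist (F3 §4) and at this model the class of `−1` is NOT absorbed by the orbit
(abc-iut-f-151's `conj_etaDdχ_eq_self_of_mem_GtpY`: the model's class descends to `Π^tp_Y`), so «order 1» is then
out of reach — a semi-synthetic artefact, not a statement about [EtTh].  HONEST FRAMING: consistency / non-vacuity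
evidence for the TYPED interface only; the ∀-closure of `Cor28_i` is refuted (abc-iut-w4-d051's `not_forall_cor28_i`);
[EtTh] is refereed and nothing of it is asserted; no side is taken on [IUTchIII] Cor 3.12; typed ≠ proved.
-/

noncomputable section

namespace Literature.AnabelianGeometry.EtaleTheta

open Literature.AnabelianGeometry.SemiGraphs ThetaCovers Literature.IUT.HodgeArakelov
open _root_.Topology
open ThetaSetting.EtaleThetaData.DoubleUnderline.OrbitEmbedding (symm_toTheta_eq)

namespace MuTwoSetting.CLevelData

variable {p : ℕ} [Fact p.Prime] {M : MuTwoSetting p}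
variable {PC : Type} [Group PC] [TopologicalSpace PC] [IsTopologicalGroup PC] [T2Space PC]

section Generic

variable (e : M.CLevelData) (ιC : M.GtpC →ₜ* PC) (hιC : IsProfiniteCompletion ιC)
  (hinj : Function.Injective ιC) (op : M.toThetaSetting.OncePuncturedData) {l : ℕ} (hodd : Odd l)
  (s : ↥M.GK →* M.PiTemp) (hsa : ∀ σ, M.aug (s σ) = (σ : GQp p)) (hsZ : ∀ σ, M.toZ (s σ) = 1)
  (hιell : ∀ c ∈ (e.piCDataOf ιC hιC).augGK.ker, c ∉ (e.piCDataOf ιC hιC).PiX →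
    ∀ d ∈ (e.piCDataOf ιC hιC).PiX ⊓ (e.piCDataOf ιC hιC).augGK.ker,
      c * d * c⁻¹ * d ∈ (e.piCDataOf ιC hιC).barTheta l)
  (hN : ((M.GtpXu l).map M.inclX).Normal) (hY : (M.GtpY.map M.inclX).Normal)
  {E : M.toThetaSetting.EtaleThetaData} (C : E.DoubleUnderline l) (hK : M.barKerTp l ≤ C.Huu)
  (hsH : ∀ σ, s σ ∈ C.Huu) {g : M.GtpC} (hgX : g ∉ M.inclX.range) (hι : C.IotaStable (e.conjX g))
  (τ τ' : ThetaSetting.NonCuspidalPoint E.toKummerData)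

/-- **Cor 2.8 (i) at `ofEmbedding (orbitEmbeddingOfHuuOfSection …)` for an ARBITRARY automorphism `Γ` of `Π^tp_C`
RESTRICTING to `Π^tp_X`** (SECTION-route cover; the twin of abc-iut-w6-d049's `cor28_i_outer_orbitEmbeddingOfHuuOfSection`
beyond inner `Γ`): given `α : Π^tp_X ≃ₜ* Π^tp_X` with `ι ∘ α = Γ ∘ ι` (Prop 2.4) and `α(Δ^tp_X) = Δ^tp_X` ([AbsAnab] 1.3.8 —
the companion `β` on `(Π^tp_X)^Θ` is then abc-iut-L6-d5's `Thm16Sub.topCompanion`, Thm 1.6 (ii), granted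
`IsQuotientMap toTheta`), ALL FOUR conclusions of `ThetaOrbitData.Cor28_i` hold — modulo `Cor28_i`'s own binders
(`IsStandard`, `Γ_Θ`/`InducesOnTheta`, `Γ(Π^tp_Ÿ) = Π^tp_Ÿ`, `Γ(Π^tp_{Ÿ̲̲}) = Π^tp_{Ÿ̲̲}`, the tower stabilities of
`Π^tp_{X̲̲}`, `Π^tp_{X̲}`) and the UNIT-FREE rigidity identity `autMap α⁻¹ β⁻¹ η̈^Θ = σ₀·η̈^Θ` with `σ₀ ∈ Π^tp_{X̲̲}` ONLY.
[cite: MochizukiEtTh2009, Cor 2.8(i) p.42] -/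
theorem cor28_i_of_comm_orbitEmbeddingOfHuuOfSection (hq : IsQuotientMap M.toTheta)
    (hC : M.toThetaSetting.Compat) (hS : M.toThetaSetting.Sec2Hyps)
    (Γ : (e.temperedCoverDataOfHuuOfSection ιC hιC hinj op hodd s hsa hsZ hιell hN hY C hK hsH hgX hι).Gtp ≃ₜ*
      (e.temperedCoverDataOfHuuOfSection ιC hιC hinj op hodd s hsa hsZ hιell hN hY C hK hsH hgX hι).Gtp)
    (α : M.PiTemp ≃ₜ* M.PiTemp)
    (hα : ∀ σ, (e.orbitEmbeddingOfHuuOfSection ιC hιC hinj op hodd s hsa hsZ hιell hN hY C hK hsH hgX hι τ τ').ι (α σ) =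
      Γ ((e.orbitEmbeddingOfHuuOfSection ιC hιC hinj op hodd s hsa hsZ hιell hN hY C hK hsH hgX hι τ τ').ι σ))
    (hΔα : M.toThetaSetting.DeltaTemp.map α.toMulEquiv.toMonoidHom = M.toThetaSetting.DeltaTemp)
    (hstd : (ThetaOrbitData.ofEmbedding
        (e.orbitEmbeddingOfHuuOfSection ιC hιC hinj op hodd s hsa hsZ hιell hN hY C hK hsH hgX hι τ τ') hC hS).IsStandard)
    (ΓΘ : (ThetaOrbitData.ofEmbedding
        (e.orbitEmbeddingOfHuuOfSection ιC hιC hinj op hodd s hsa hsZ hιell hN hY C hK hsH hgX hι τ τ') hC hS).DeltaTheta ≃*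
      (ThetaOrbitData.ofEmbedding
        (e.orbitEmbeddingOfHuuOfSection ιC hιC hinj op hodd s hsa hsZ hιell hN hY C hK hsH hgX hι τ τ') hC hS).DeltaTheta)
    (hind : (ThetaOrbitData.ofEmbedding
        (e.orbitEmbeddingOfHuuOfSection ιC hιC hinj op hodd s hsa hsZ hιell hN hY C hK hsH hgX hι τ τ') hC hS).InducesOnTheta
      Γ ΓΘ)
    (hYmap : (e.temperedCoverDataOfHuuOfSection ιC hιC hinj op hodd s hsa hsZ hιell hN hY C hK hsH hgX hι).PiYddtp.map
        Γ.toMulEquiv.toMonoidHom =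
      (e.temperedCoverDataOfHuuOfSection ιC hιC hinj op hodd s hsa hsZ hιell hN hY C hK hsH hgX hι).PiYddtp)
    (hYuu : ((e.temperedCoverDataOfHuuOfSection ιC hιC hinj op hodd s hsa hsZ hιell hN hY C hK hsH hgX hι).PiYddtp ⊓
          (e.temperedCoverDataOfHuuOfSection ιC hιC hinj op hodd s hsa hsZ hιell hN hY C hK hsH hgX hι).tp
            (e.temperedCoverDataOfHuuOfSection ιC hιC hinj op hodd s hsa hsZ hιell hN hY C hK hsH hgX hι).PiXuu).map
        Γ.toMulEquiv.toMonoidHom =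
      (e.temperedCoverDataOfHuuOfSection ιC hιC hinj op hodd s hsa hsZ hιell hN hY C hK hsH hgX hι).PiYddtp ⊓
        (e.temperedCoverDataOfHuuOfSection ιC hιC hinj op hodd s hsa hsZ hιell hN hY C hK hsH hgX hι).tp
          (e.temperedCoverDataOfHuuOfSection ιC hιC hinj op hodd s hsa hsZ hιell hN hY C hK hsH hgX hι).PiXuu)
    (hXuumap : ((e.temperedCoverDataOfHuuOfSection ιC hιC hinj op hodd s hsa hsZ hιell hN hY C hK hsH hgX hι).tp
          (e.temperedCoverDataOfHuuOfSection ιC hιC hinj op hodd s hsa hsZ hιell hN hY C hK hsH hgX hι).PiXuu).map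
        Γ.toMulEquiv.toMonoidHom =
      (e.temperedCoverDataOfHuuOfSection ιC hιC hinj op hodd s hsa hsZ hιell hN hY C hK hsH hgX hι).tp
        (e.temperedCoverDataOfHuuOfSection ιC hιC hinj op hodd s hsa hsZ hιell hN hY C hK hsH hgX hι).PiXuu)
    (hXumap : ((e.temperedCoverDataOfHuuOfSection ιC hιC hinj op hodd s hsa hsZ hιell hN hY C hK hsH hgX hι).tp
          (e.temperedCoverDataOfHuuOfSection ιC hιC hinj op hodd s hsa hsZ hιell hN hY C hK hsH hgX hι).PiXu).map
        Γ.toMulEquiv.toMonoidHom =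
      (e.temperedCoverDataOfHuuOfSection ιC hιC hinj op hodd s hsa hsZ hιell hN hY C hK hsH hgX hι).tp
        (e.temperedCoverDataOfHuuOfSection ιC hιC hinj op hodd s hsa hsZ hιell hN hY C hK hsH hgX hι).PiXu)
    {σ₀ : M.PiTemp} (hσ₀ : σ₀ ∈ C.Huu)
    (hη : ∀ (hΔ' : ∀ a, a ∈ M.toThetaSetting.DeltaTheta →
          (Thm16Sub.topCompanion M.toThetaSetting M.toThetaSetting α hΔα hq hq).symm a ∈ M.toThetaSetting.DeltaTheta)
        (hYα : ∀ g, g ∈ M.toThetaSetting.GtpYdd → α g ∈ M.toThetaSetting.GtpYdd),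
      haveI := hC.GtpYdd_normal
      ContH1Aut.autMap M.toTheta M.toThetaSetting.DeltaTheta α.symm
          (Thm16Sub.topCompanion M.toThetaSetting M.toThetaSetting α hΔα hq hq).symm
          (symm_toTheta_eq (fun σ => Thm16Sub.algCompanion_apply_toTheta M.toThetaSetting M.toThetaSetting α hΔα σ)) hΔ'
          (H := M.toThetaSetting.GtpYdd) (H' := M.toThetaSetting.GtpYdd) hYα E.etaDd =
        ContH1.conj M.toTheta M.toThetaSetting.DeltaTheta σ₀ E.etaDd) :
    (ThetaOrbitData.ofEmbedding
        (e.orbitEmbeddingOfHuuOfSection ιC hιC hinj op hodd s hsa hsZ hιell hN hY C hK hsH hgX hι τ τ') hC hS).IsStandardColl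
        ((ThetaOrbitData.ofEmbedding
            (e.orbitEmbeddingOfHuuOfSection ιC hιC hinj op hodd s hsa hsZ hιell hN hY C hK hsH hgX hι τ τ') hC hS).transport _
          Γ hYmap ΓΘ
          (ThetaOrbitData.ofEmbedding
            (e.orbitEmbeddingOfHuuOfSection ιC hιC hinj op hodd s hsa hsZ hιell hN hY C hK hsH hgX hι τ τ') hC hS).etaZMu2) ∧
      (ThetaOrbitData.ofEmbedding
          (e.orbitEmbeddingOfHuuOfSection ιC hιC hinj op hodd s hsa hsZ hιell hN hY C hK hsH hgX hι τ τ') hC hS).EqUpToRootOfUnity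
          l _
        (ThetaOrbitData.ofEmbedding
          (e.orbitEmbeddingOfHuuOfSection ιC hιC hinj op hodd s hsa hsZ hιell hN hY C hK hsH hgX hι τ τ') hC hS).rootLZMu2
        ((ThetaOrbitData.ofEmbedding
            (e.orbitEmbeddingOfHuuOfSection ιC hιC hinj op hodd s hsa hsZ hιell hN hY C hK hsH hgX hι τ τ') hC hS).transport _
          Γ hYuu ΓΘ
          (ThetaOrbitData.ofEmbedding
            (e.orbitEmbeddingOfHuuOfSection ιC hιC hinj op hodd s hsa hsZ hιell hN hY C hK hsH hgX hι τ τ') hC hS).rootLZMu2) ∧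
      (ThetaOrbitData.ofEmbedding
          (e.orbitEmbeddingOfHuuOfSection ιC hιC hinj op hodd s hsa hsZ hιell hN hY C hK hsH hgX hι τ τ') hC hS).EqUpToRootOfUnity
          1 _
        (ThetaOrbitData.ofEmbedding
          (e.orbitEmbeddingOfHuuOfSection ιC hιC hinj op hodd s hsa hsZ hιell hN hY C hK hsH hgX hι τ τ') hC hS).etaZMu2
        ((ThetaOrbitData.ofEmbedding
            (e.orbitEmbeddingOfHuuOfSection ιC hιC hinj op hodd s hsa hsZ hιell hN hY C hK hsH hgX hι τ τ') hC hS).transport _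
          Γ hYmap ΓΘ
          (ThetaOrbitData.ofEmbedding
            (e.orbitEmbeddingOfHuuOfSection ιC hιC hinj op hodd s hsa hsZ hιell hN hY C hK hsH hgX hι τ τ') hC hS).etaZMu2) ∧
      (ThetaOrbitData.ofEmbedding
          (e.orbitEmbeddingOfHuuOfSection ιC hιC hinj op hodd s hsa hsZ hιell hN hY C hK hsH hgX hι τ τ') hC hS).EqUpToRootOfUnity
          1 _
        (ThetaOrbitData.ofEmbedding
          (e.orbitEmbeddingOfHuuOfSection ιC hιC hinj op hodd s hsa hsZ hιell hN hY C hK hsH hgX hι τ τ') hC hS).etaLZMu2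
        ((ThetaOrbitData.ofEmbedding
            (e.orbitEmbeddingOfHuuOfSection ιC hιC hinj op hodd s hsa hsZ hιell hN hY C hK hsH hgX hι τ τ') hC hS).transport _
          Γ hYmap ΓΘ
          (ThetaOrbitData.ofEmbedding
            (e.orbitEmbeddingOfHuuOfSection ιC hιC hinj op hodd s hsa hsZ hιell hN hY C hK hsH hgX hι τ τ') hC hS).etaLZMu2) :=
  (e.orbitEmbeddingOfHuuOfSection ιC hιC hinj op hodd s hsa hsZ hιell hN hY C hK hsH hgX hι τ τ').ofEmbedding_cor28_i_of_comm_reduced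
    hC hS hstd hα (fun σ => Thm16Sub.algCompanion_apply_toTheta M.toThetaSetting M.toThetaSetting α hΔα σ)
    (e.orbitEmbeddingOfHuuOfSection_map_GtpXu ιC hιC hinj op hodd s hsa hsZ hιell hN hY C hK hsH hgX hι τ τ')
    ΓΘ hind hYmap hYuu hXuumap hXumap hσ₀ hη

end Generic

end MuTwoSetting.CLevelData


end Literature.AnabelianGeometry.EtaleTheta

end
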